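import Summits.RiemannHypothesis.RiemannHypothesis.Theorems.WeilWindowFlowWindowLipschitzStubGroundStateEnergy
import Summits.RiemannHypothesis.RiemannHypothesis.Theorems.WeilWindowFlowWindowLipschitzStubLocalizedCutAux2
import Summits.RiemannHypothesis.RiemannHypothesis.Theorems.OddSectorOddOneSignedWindowsFormDomainDilation
import HarnessLib

/-!
# The touching dilation family of a Weil ground state (pub-rhpf, theory-1; helper for crux
# `EvenSectorBarta.EvenOneSignedWindows`, item stmt-RiemannHypothesis-19953; RH-free)

**mechanism/rigidity campaign; no RH claims.**  Companion text:
`run/shared/lean/pub/pub-rhpf/pub-rhpf-theory-1/THEORY-EDGE-3.md`. This file is the trial-family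
half of the Hadamard–Hellmann–Feynman EDGE LAW for the window bottom `ε(a) = weilGroundEnergy a`
(`PfPersistenceEdgeLaw.lean`): Bombieri's unitary dilation `weilDilate η : f ↦ (1+η)^{1/2} f((1+η)·)`
moves a state of the window `[-a, a]` to the window `[-a/(1+η), a/(1+η)]` — the parameter MOVES THE
DOMAIN (Hadamard 1908) — and the closed Weil form along this orbit TOUCHES the ground level from
above at `η = 0`. Everything here is PROVED (sorry-free) and holds for every ground state, with no
simplicity or regularity hypothesis.

* `weilClosedForm A f = P(f) + 𝓔_A(f) − M_A ∫|f|²` — the closed form read at the reference window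
  `[-A, A]` (`= Re Q(f)` on tests supported there, `weilClosedForm_eq_re_weilQuadratic`; independent
  of `A` beyond the support radius, `stub_localizedCut_energy_window`).
* `weilTrunc a u = 1_{(-a,a)} u` — a.e. equal to the ground state `u` (`ae_eq_weilTrunc`) and again a
  ground state (`isWeilGroundState_weilTrunc`); it vanishes at EVERY `|x| ≥ a`.
* `weilDilationProfile a u η = weilClosedForm (2a) (weilDilate η (weilTrunc a u))` — the DILATION
  PROFILE of `u`; its derivative at `η = 0`, when it exists, is the dilation virial of `u`.
* `integrableOn_arch_weilDilate` — dilates (`-1 < η ≤ 1`) of finite-energy window functions have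
  finite archimedean energy (`ρ` decreasing + `ρ(s/2) ≤ 2e^{s/4}ρ(s)`, `weilArchDensity_half_le`).
* `weilGroundEnergy_div_le_weilDilationProfile` (TOUCHING FROM ABOVE, `-1/2 ≤ η ≤ 1`):
  `ε(a/(1+η)) ≤ weilDilationProfile a u η` — the dilate is a unit finite-energy state of the window
  `a/(1+η)` and `C_c^∞` is dense from above in the form domain (`stub_formDomainPos`).
* `weilDilationProfile_zero` (CONTACT): `weilDilationProfile a u 0 = ε(a)` (`stub_formDomainPos` +
  `stub_groundStateEnergy`: `P(ũ) + 𝓔_a(ũ) = M_a + ε(a)`).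
* Typed vocabulary of the edge dictionary (DEFINITIONS used only as explicit hypotheses downstream —
  posited / DERIVED in THEORY-EDGE-3 §2, NOT facts): `edgeMass u a r = ∫_{a-r<|x|} |u|²`,
  `HasEdgeIntensity u a I` (`(log(1/r)/r) · edgeMass u a r → I`, `I = τ₊² + τ₋²` = squared edge
  traces), `edgeLawKernelConstant = c₀ = 1/2` (`t ρ(t) → 1/2`: `tendsto_mul_weilArchDensity` in
  `Literature/NumberTheory/LFunctions/WeilArchDensityAsymptotics.lean`), and `WeilLogPohozaevAt a`
  (the log-Pohozaev edge identity `V = 2c₀ · a · I` for the ground states of the window `a`).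

References: E. Bombieri, Rend. Mat. Acc. Lincei (9) 11 (2000) 183–233, §4 (Thm 3; proof of Thm 5:
the dilation `f_ε`); M. Fukushima, Y. Oshima, M. Takeda, *Dirichlet Forms and Symmetric Markov
Processes* (2011) §1.1; J. Hadamard, Mém. prés. div. sav. Acad. Sci. 33 (1908).
-/

set_option linter.dupNamespace false

noncomputable section

open MeasureTheory Set Filter
open scoped Topology

namespace Summit.RiemannHypothesis.RiemannHypothesis.Theorems.PfPersistence

open Literature.NumberTheory.LFunctions
open Summit.RiemannHypothesis.RiemannHypothesis.Theorems.WeilWindowFlowWindowLipschitz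
  (stub_formDomainPos stub_groundStateEnergy stub_localizedCut_energy_window
    stub_localizedCut_weilIncrement_eq_two_mul stub_localizedCut_aesm_weilIncrement)
open Summit.RiemannHypothesis.RiemannHypothesis.Theorems.OddSector
  (memLp_weilDilate weilArchDensity_half_le)

/-! ## The closed form, the open-window truncation and the dilation profile -/

/-- The **closed Weil form read at the reference window `[-A, A]`**:
`P(f) + 𝓔_A(f) − M_A ∫|f|²`; equals `Re Q(f)` on test functions supported in `[-A, A]`
(`weilClosedForm_eq_re_weilQuadratic`) and does not depend on `A` beyond the support radius
(`stub_localizedCut_energy_window`). [cite: Bombieri2000Weil, Thm 2 (p. 193)] -/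
def weilClosedForm (A : ℝ) (f : ℝ → ℂ) : ℝ :=
  weilPoleForm f + weilDirichletEnergy A f - weilMarkovConstant A * ∫ x, ‖f x‖ ^ 2

/-- The **open-window truncation** `ũ = 1_{(-a,a)} u` (a.e. equal to a ground state `u` of the
window, `ae_eq_weilTrunc`; it vanishes at EVERY `|x| ≥ a`). [folklore] -/
def weilTrunc (a : ℝ) (u : ℝ → ℂ) : ℝ → ℂ :=
  (Ioo (-a) a).indicator u

/-- The **dilation profile** of a window state: `η ↦ P(ũ_η) + 𝓔_{2a}(ũ_η) − M_{2a}‖ũ_η‖²` with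
`ũ_η = weilDilate η ũ` living on the window `a/(1+η)` (read at the fixed reference window `2a`,
legitimate for `η ≥ -1/2`). Its derivative at `η = 0`, when it exists, is the DILATION VIRIAL of `u`.
[cite: Bombieri2000Weil, §4 proof of Thm 5 (the dilation)] -/
def weilDilationProfile (a : ℝ) (u : ℝ → ℂ) (η : ℝ) : ℝ :=
  weilClosedForm (2 * a) (weilDilate η (weilTrunc a u))

/-- On a test function supported in `[-A, A]` the closed form is `Re Q`. [cite: Bombieri2000Weil, Thm 2 (p. 193)] -/
theorem weilClosedForm_eq_re_weilQuadratic {g : ℝ → ℂ} (hg : IsWeilTest g) {A : ℝ}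
    (hsupp : tsupport g ⊆ Icc (-A) A) : weilClosedForm A g = (weilQuadratic g).re := by
  rw [weilClosedForm, weilQuadratic_re_eq_weilPoleForm_add_weilDirichletEnergy_sub hg hsupp]

/-- The truncation vanishes at every `|x| ≥ a`. [folklore] -/
theorem weilTrunc_eq_zero {a : ℝ} (u : ℝ → ℂ) {x : ℝ} (hx : a ≤ |x|) : weilTrunc a u x = 0 :=
  indicator_of_notMem (fun h : x ∈ Ioo (-a) a ↦ hx.not_gt (abs_lt.2 h)) _

/-- A function vanishing at every `|x| ≥ a` is its own truncation. [folklore] -/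
theorem weilTrunc_eq_self {a : ℝ} {g : ℝ → ℂ} (hg : ∀ x, a ≤ |x| → g x = 0) :
    weilTrunc a g = g := by
  funext x
  unfold weilTrunc
  by_cases hm : x ∈ Ioo (-a) a
  · exact indicator_of_mem hm _
  · rw [indicator_of_notMem hm]
    refine (hg x ?_).symm
    by_contra h
    exact hm (abs_lt.1 (not_le.1 h))

/-- A ground state agrees a.e. with its open-window truncation (it vanishes a.e. off `[-a, a]`,
`IsWeilGroundState.ae_eq_zero_of_notMem`, and the endpoints are null). [cite: Bombieri2000Weil, §4 Problem 2 and Thm 3] -/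
theorem ae_eq_weilTrunc {a : ℝ} {u : ℝ → ℂ} (hu : IsWeilGroundState a u) :
    u =ᵐ[volume] weilTrunc a u := by
  filter_upwards [hu.ae_eq_zero_of_notMem, Measure.ae_ne volume (-a), Measure.ae_ne volume a]
    with x hx h1 h2
  unfold weilTrunc
  by_cases hm : x ∈ Ioo (-a) a
  · rw [indicator_of_mem hm]
  · rw [indicator_of_notMem hm]
    exact hx fun hI ↦ hm ⟨lt_of_le_of_ne hI.1 (fun h ↦ h1 h.symm), lt_of_le_of_ne hI.2 h2⟩

/-- The truncation of a ground state is a ground state of the same window. [cite: Bombieri2000Weil, §4 Thm 3] -/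
theorem isWeilGroundState_weilTrunc {a : ℝ} {u : ℝ → ℂ} (hu : IsWeilGroundState a u) :
    IsWeilGroundState a (weilTrunc a u) :=
  hu.congr_ae (ae_eq_weilTrunc hu)

/-- A dilate of a function vanishing at every `|x| ≥ b` vanishes at every `|x| ≥ b/(1+η)`
(`η > -1`). [folklore] -/
theorem weilDilate_eq_zero_of_le_abs {f : ℝ → ℂ} {b η : ℝ} (hη : -1 < η)
    (hfs : ∀ x, b ≤ |x| → f x = 0) {x : ℝ} (hx : b / (1 + η) ≤ |x|) : weilDilate η f x = 0 := by
  have hc : 0 < 1 + η := by linarith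
  rw [weilDilate_apply, hfs _ ?_, mul_zero]
  rw [abs_mul, abs_of_pos hc]
  rwa [div_le_iff₀' hc] at hx

/-! ## The archimedean energy of a dilate is finite -/

/-- Comparison of the archimedean density under rescaling of the jump length: for `0 < s ≤ 2b` and
`0 < c ≤ 2`, `ρ(s/c) ≤ 2 e^{b/2} ρ(s)` (`ρ` is decreasing, and `ρ(s/2) ≤ 2e^{s/4} ρ(s)`). [folklore] -/
theorem weilArchDensity_div_le {s c b : ℝ} (hs : 0 < s) (hsb : s ≤ 2 * b) (hc : 0 < c)
    (hc2 : c ≤ 2) : weilArchDensity (s / c) ≤ 2 * Real.exp (b / 2) * weilArchDensity s := by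
  have hρ : 0 ≤ weilArchDensity s := (weilArchDensity_pos hs).le
  have hK : 1 ≤ 2 * Real.exp (b / 2) := by
    have h1 := Real.add_one_le_exp (b / 2)
    linarith
  by_cases hc1 : c ≤ 1
  · calc weilArchDensity (s / c) ≤ weilArchDensity s :=
          weilArchDensity_antitoneOn (mem_Ioi.2 hs) (mem_Ioi.2 (div_pos hs hc))
            (le_div_self hs.le hc hc1)
      _ ≤ 2 * Real.exp (b / 2) * weilArchDensity s := le_mul_of_one_le_left hρ hK
  · calc weilArchDensity (s / c) ≤ weilArchDensity (s / 2) :=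
          weilArchDensity_antitoneOn (mem_Ioi.2 (by positivity)) (mem_Ioi.2 (div_pos hs hc))
            (div_le_div_of_nonneg_left hs.le hc hc2)
      _ ≤ 2 * Real.exp (s / 4) * weilArchDensity s := weilArchDensity_half_le hs
      _ ≤ 2 * Real.exp (b / 2) * weilArchDensity s := by
          apply mul_le_mul_of_nonneg_right _ hρ
          have : Real.exp (s / 4) ≤ Real.exp (b / 2) := Real.exp_le_exp.2 (by linarith)
          linarith

/-- **Dilates of finite-energy window functions have finite archimedean energy.** For `f ∈ L²`
vanishing at every `|x| ≥ b` (`b > 0`) with `ρ D(f)` integrable on `(0, ∞)` and `-1 < η ≤ 1`, the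
density `ρ D(f_η)` of the dilate `f_η = weilDilate η f` is integrable on `(0, ∞)`
(`D_t(f_η) = D_{(1+η)t}(f)`; substitute `s = (1+η)t`; near `0` compare `ρ(s/(1+η)) ≤ 2e^{b/2}ρ(s)`,
beyond `2b` use `D_s(f) = 2‖f‖²` and the integrability of `ρ` at infinity). [folklore] -/
theorem integrableOn_arch_weilDilate {f : ℝ → ℂ} {b η : ℝ} (hb : 0 < b) (hη : -1 < η)
    (hη1 : η ≤ 1) (hf : MemLp f 2) (hfs : ∀ x, b ≤ |x| → f x = 0)
    (hE : IntegrableOn (fun t ↦ weilArchDensity t * weilIncrement f t) (Ioi 0)) :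
    IntegrableOn (fun t ↦ weilArchDensity t * weilIncrement (weilDilate η f) t) (Ioi 0) := by
  have hc : 0 < 1 + η := by linarith
  obtain ⟨G, hG⟩ : ∃ G : ℝ → ℝ,
      G = fun s ↦ weilArchDensity (s / (1 + η)) * weilIncrement f s := ⟨_, rfl⟩
  -- the integrand is `G ((1+η) t)`
  have hfun : (fun t ↦ weilArchDensity t * weilIncrement (weilDilate η f) t) =
      fun t ↦ G ((1 + η) * t) := by
    funext t
    simp only [hG, weilIncrement_weilDilate f hη, mul_div_cancel_left₀ t hc.ne']
  rw [hfun, integrableOn_Ioi_comp_mul_left_iff G 0 hc, mul_zero]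
  have hGm : AEStronglyMeasurable G volume := by
    rw [hG]
    have h1 : AEStronglyMeasurable (fun s : ℝ ↦ weilArchDensity (s / (1 + η))) volume :=
      (measurable_weilArchDensity.comp (measurable_id.div_const (1 + η))).aestronglyMeasurable
    exact h1.mul (stub_localizedCut_aesm_weilIncrement hf.1)
  -- small jumps: domination by `2 e^{b/2} ρ D(f)`
  have hnear : IntegrableOn G (Ioc 0 (2 * b)) := by
    have hdom : IntegrableOn
        (fun s ↦ 2 * Real.exp (b / 2) * (weilArchDensity s * weilIncrement f s)) (Ioc 0 (2 * b)) :=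
      (hE.mono_set Ioc_subset_Ioi_self).const_mul _
    refine hdom.mono' hGm.restrict ?_
    refine (ae_restrict_iff' measurableSet_Ioc).2 (Eventually.of_forall fun s hs ↦ ?_)
    have hs0 : 0 < s := hs.1
    have hD : 0 ≤ weilIncrement f s := weilIncrement_nonneg f s
    simp only [hG]
    rw [Real.norm_of_nonneg (mul_nonneg (weilArchDensity_pos (div_pos hs0 hc)).le hD)]
    calc weilArchDensity (s / (1 + η)) * weilIncrement f s
        ≤ 2 * Real.exp (b / 2) * weilArchDensity s * weilIncrement f s :=
          mul_le_mul_of_nonneg_right (weilArchDensity_div_le hs0 hs.2 hc (by linarith)) hD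
      _ = 2 * Real.exp (b / 2) * (weilArchDensity s * weilIncrement f s) := by ring
  -- large jumps: `D_s(f) = 2‖f‖²` and `ρ` is integrable at infinity
  have hfar : IntegrableOn G (Ioi (2 * b)) := by
    have hρ : IntegrableOn (fun s ↦ weilArchDensity ((1 + η)⁻¹ * s)) (Ioi (2 * b)) := by
      rw [integrableOn_Ioi_comp_mul_left_iff weilArchDensity (2 * b) (inv_pos.2 hc)]
      exact integrableOn_weilArchDensity_Ioi (mul_pos (inv_pos.2 hc) (mul_pos two_pos hb))
    refine IntegrableOn.congr_fun (hρ.mul_const (2 * ∫ x, ‖f x‖ ^ 2)) (fun s hs ↦ ?_)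
      measurableSet_Ioi
    simp only [hG, div_eq_inv_mul,
      stub_localizedCut_weilIncrement_eq_two_mul hf hfs (le_of_lt (mem_Ioi.1 hs))]
  have hall := hnear.union hfar
  rwa [Ioc_union_Ioi_eq_Ioi (by positivity : (0 : ℝ) ≤ 2 * b)] at hall

/-! ## Touching: the ground level lies below the profile, with contact at `η = 0` -/

/-- **The ground level is touched from above by the dilation profile of any ground state.** For a
ground state `u` of the window `a` and `-1/2 ≤ η ≤ 1`: `ε(a/(1+η)) ≤ weilDilationProfile a u η`.
[cite: Bombieri2000Weil, §4 proof of Thm 5 (the dilation)] -/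
theorem weilGroundEnergy_div_le_weilDilationProfile {a : ℝ} {u : ℝ → ℂ}
    (hu : IsWeilGroundState a u) {η : ℝ} (hη : -(1 / 2 : ℝ) ≤ η) (hη1 : η ≤ 1) :
    weilGroundEnergy (a / (1 + η)) ≤ weilDilationProfile a u η := by
  have ha : 0 < a := hu.pos
  have hη' : -1 < η := by linarith
  have hc : 0 < 1 + η := by linarith
  have hvg : IsWeilGroundState a (weilTrunc a u) := isWeilGroundState_weilTrunc hu
  have hv2 : MemLp (weilTrunc a u) 2 := hvg.memLp
  have hvs : ∀ x, a ≤ |x| → weilTrunc a u x = 0 := fun x hx ↦ weilTrunc_eq_zero u hx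
  have hvE := (stub_groundStateEnergy a _ hvg).1
  have hf2 : MemLp (weilDilate η (weilTrunc a u)) 2 := memLp_weilDilate hv2 hη'
  have hfs : ∀ x, a / (1 + η) ≤ |x| → weilDilate η (weilTrunc a u) x = 0 :=
    fun x hx ↦ weilDilate_eq_zero_of_le_abs hη' hvs hx
  have hfE := integrableOn_arch_weilDilate ha hη' hη1 hv2 hvs hvE
  have hfN : ∫ x, ‖weilDilate η (weilTrunc a u) x‖ ^ 2 = 1 := by
    rw [integral_norm_sq_weilDilate _ hη', hvg.integral_norm_sq]
  have hb : 0 < a / (1 + η) := div_pos ha hc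
  have hC1 := stub_formDomainPos (a / (1 + η)) hb _ hf2
    (Eventually.of_forall fun x hx ↦ hfs x (not_le.1 fun h ↦ hx (abs_le.1 h)).le) hfE
  have hb2 : a / (1 + η) ≤ 2 * a := by
    rw [div_le_iff₀ hc]
    have : 0 ≤ a * (1 + 2 * η) := mul_nonneg ha.le (by linarith)
    linarith
  have hW := stub_localizedCut_energy_window hf2 hb2 hfs
  rw [hfN, mul_one] at hC1
  rw [hfN, mul_one, mul_one] at hW
  unfold weilDilationProfile weilClosedForm
  rw [hfN, mul_one]
  linarith

/-- **Contact at `η = 0`**: `weilDilationProfile a u 0 = ε(a)` for every ground state `u` of the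
window `a` (`P(ũ) + 𝓔_a(ũ) = M_a + ε(a)`: `≥` is density of `C_c^∞` from above, `≤` is lower
semicontinuity along the minimising sequence). [cite: Bombieri2000Weil, §4 Thm 3] -/
theorem weilDilationProfile_zero {a : ℝ} {u : ℝ → ℂ} (hu : IsWeilGroundState a u) :
    weilDilationProfile a u 0 = weilGroundEnergy a := by
  have ha : 0 < a := hu.pos
  have hvg : IsWeilGroundState a (weilTrunc a u) := isWeilGroundState_weilTrunc hu
  have hv2 : MemLp (weilTrunc a u) 2 := hvg.memLp
  have hvs : ∀ x, a ≤ |x| → weilTrunc a u x = 0 := fun x hx ↦ weilTrunc_eq_zero u hx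
  obtain ⟨hvE, hC2⟩ := stub_groundStateEnergy a _ hvg
  have hN : ∫ x, ‖weilTrunc a u x‖ ^ 2 = 1 := hvg.integral_norm_sq
  have hC1 := stub_formDomainPos a ha _ hv2
    (Eventually.of_forall fun x hx ↦ hvs x (not_le.1 fun h ↦ hx (abs_le.1 h)).le) hvE
  have hW := stub_localizedCut_energy_window hv2 (by linarith : a ≤ 2 * a) hvs
  rw [hN, mul_one] at hC1 hC2
  rw [hN, mul_one, mul_one] at hW
  unfold weilDilationProfile weilClosedForm
  rw [weilDilate_zero, hN, mul_one]
  linarith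

/-- The touching inequality holds for all `η` near `0`. [folklore] -/
theorem eventually_weilGroundEnergy_div_le {a : ℝ} {u : ℝ → ℂ} (hu : IsWeilGroundState a u) :
    ∀ᶠ η in 𝓝 (0 : ℝ), weilGroundEnergy (a / (1 + η)) ≤ weilDilationProfile a u η := by
  filter_upwards [Icc_mem_nhds (show (-(1 / 2 : ℝ)) < 0 by norm_num) (show (0 : ℝ) < 1 by norm_num)]
    with η hη
  exact weilGroundEnergy_div_le_weilDilationProfile hu hη.1 hη.2

/-! ## Edge intensity and the log-Pohozaev identity: typed vocabulary (hypotheses, not facts) -/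

/-- The constant `c₀ = 1/2` of the edge law: the archimedean density is half a logarithmic
Laplacian at short range, `t · weilArchDensity t → 1/2`
(`Literature.NumberTheory.LFunctions.tendsto_mul_weilArchDensity`). [folklore] -/
def edgeLawKernelConstant : ℝ := 1 / 2

/-- The **two-edge mass at depth `r`** of a window state: `∫_{a - r < |x|} ‖u x‖²`. [folklore] -/
def edgeMass (u : ℝ → ℂ) (a r : ℝ) : ℝ :=
  ∫ x in {x : ℝ | a - r < |x|}, ‖u x‖ ^ 2

/-- **Edge intensity** `I` of a window state: `(log(1/r)/r) · edgeMass u a r → I` as `r → 0⁺`.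
For `‖u(x)‖² ∼ τ_±² / log(1/(a ∓ x))` at the two edges, `I = τ₊² + τ₋²` (squared EDGE TRACES). A
DEFINITION used only as an explicit hypothesis; existence of the limit for Weil ground states is NOT
known (the tree proves `edgeMass = O(r/log(1/r))`, `WeilWindowFlowWindowLipschitz`). [folklore] -/
def HasEdgeIntensity (u : ℝ → ℂ) (a I : ℝ) : Prop :=
  Tendsto (fun r : ℝ ↦ Real.log (1 / r) / r * edgeMass u a r) (𝓝[>] 0) (𝓝 I)

/-- **The log-Pohozaev edge identity at the window `a`**: every ground state `u` of the window with
a dilation virial `V` and an edge intensity `I` has `V = 2c₀ · a · I` (`2c₀ = 1`). DERIVED in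
THEORY-EDGE-3 §2 (bulk terms of the virial cancel against the Euler–Lagrange equation paired with
the dilation generator; the flux of the `c₀/t` singularity through the two edges survives — the
order-zero analogue of the fractional Pohozaev identity), NOT proved: a DEFINITION used only as an
explicit hypothesis — posited, not a fact. [folklore] -/
def WeilLogPohozaevAt (a : ℝ) : Prop :=
  ∀ (u : ℝ → ℂ) (V I : ℝ), IsWeilGroundState a u →
    HasDerivAt (weilDilationProfile a u) V 0 → HasEdgeIntensity u a I →
      V = 2 * edgeLawKernelConstant * a * I

end Summit.RiemannHypothesis.RiemannHypothesis.Theorems.PfPersistence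

end
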